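import Mathlib
import HarnessLib
import Literature.Analysis.FluidPDE.AxisymQuotientEquationsJ
import Summits.NavierStokesRegularity.NavierStokesRegularity.Theorems.TypeIQuarterGateScarEnvelopeTypeIForcedTsaiFieldCalculus
import Summits.NavierStokesRegularity.NavierStokesRegularity.Theorems.TypeIQuarterGateScarEnvelopeTypeIForcedTsaiFieldSmooth

/-!
# ARM B lane E-exact — the VORTICITY RESIDUAL of the witness (stub S3): `g = e^{−a|y|²}·g₁ + e^{−2a|y|²}·g₂`

For `U = e^{−a|y|²}·u` (`u = curl_a p` symbolic): the steady backward Leray momentum residual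
`−ΔU + ½U + ½DU(y)[y] + (U·∇)U` equals `e^{−a|y|²}·(linPart a u) + e^{−2a|y|²}·(nlPart a u)` componentwise
(`Δ` through `laplacian_apply_coord_vec3` and the sum of pure second partials; `DU(y)[v] = Σ_j v_j ∂_jU`;
`∂_j (e^{−b|y|²}Q) = e^{−b|y|²}(Dg b j Q)`), and the curl of a field `e^{−b|y|²}·V` is `e^{−b|y|²}·curl_b V`
(`curl_gaussVec`, curl additive) — hence `lerayVorticityResidual U = e^{−a|y|²}·g₁ + e^{−2a|y|²}·g₂` with
the checker's `g₁ = curl_a (linPart a u)`, `g₂ = curl_{2a} (nlPart a u)`.  Nothing here bears on NS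
regularity.
-/

noncomputable section

set_option linter.dupNamespace false

namespace Summit.NavierStokesRegularity.NavierStokesRegularity.Cruxes.ScarEnvelopeTypeI.ForcedTsai

open scoped ContDiff Laplacian InnerProductSpace RealInnerProductSpace
open Literature.Analysis.FluidPDE

/-! ## Scalar Gaussian × polynomial functions -/

/-- `∂_j (e^{−b|y|²} Q(y)) = e^{−b|y|²} (Dg b j Q)(y)`. -/
theorem fderiv_gaussPoly_single (b : ℚ) (Q : QPoly) (y : E3) (j : Fin 3) :
    fderiv ℝ (fun y => gauss (b : ℝ) y * QPoly.eval Q y) y (EuclideanSpace.single j 1) =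
      gauss (b : ℝ) y * QPoly.eval (Dg b j Q) y := by
  rw [show (fun y => gauss (b : ℝ) y * QPoly.eval Q y) = gauss (b : ℝ) * fun y => QPoly.eval Q y from rfl,
    fderiv_mul (differentiableAt_gauss _ y) (QPoly.differentiableAt_eval _ y)]
  simp only [FunLike.coe_add, FunLike.coe_smul, Pi.add_apply, Pi.smul_apply, smul_eq_mul]
  rw [fderiv_gauss_single, QPoly.fderiv_eval_single, eval_Dg]
  ring

/-- Gaussian × polynomial functions are differentiable. -/
theorem differentiableAt_gaussPoly (b : ℝ) (Q : QPoly) (y : E3) :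
    DifferentiableAt ℝ (fun y => gauss b y * QPoly.eval Q y) y :=
  (differentiableAt_gauss _ y).mul (QPoly.differentiableAt_eval _ y)

/-- Gaussian × polynomial functions are smooth. -/
theorem contDiff_gaussPoly (b : ℝ) (Q : QPoly) {n : WithTop ℕ∞} :
    ContDiff ℝ n (fun y => gauss b y * QPoly.eval Q y) :=
  (contDiff_gauss b).mul (QPoly.contDiff_eval Q)

/-- A continuous linear functional on `ℝ³` evaluated at `v` is `Σ_j v_j · (value at e_j)`. -/
theorem clm_apply_eq_sum (L : E3 →L[ℝ] ℝ) (v : E3) :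
    L v = ∑ j : Fin 3, v j * L (EuclideanSpace.single j 1) := by
  conv_lhs => rw [← (EuclideanSpace.basisFun (Fin 3) ℝ).sum_repr v]
  rw [map_sum]
  refine Finset.sum_congr rfl fun j _ => ?_
  rw [map_smul, EuclideanSpace.basisFun_repr, EuclideanSpace.basisFun_apply, smul_eq_mul]

/-! ## Vector Gaussian × polynomial fields -/

/-- The field `e^{−b|y|²}·V(y)` for a symbolic vector `V`. -/
def gaussVec (b : ℝ) (V : Fin 3 → QPoly) : E3 → E3 := fun y => gauss b y • evalVec V y

/-- Components of `e^{−b|y|²}·V`. -/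
theorem gaussVec_apply (b : ℝ) (V : Fin 3 → QPoly) (y : E3) (i : Fin 3) :
    gaussVec b V y i = gauss b y * QPoly.eval (V i) y := by
  simp [gaussVec, evalVec, PiLp.smul_apply]

/-- `e^{−b|y|²}·V` is differentiable. -/
theorem differentiableAt_gaussVec (b : ℝ) (V : Fin 3 → QPoly) (y : E3) : DifferentiableAt ℝ (gaussVec b V) y :=
  differentiableAt_euclidean.mpr fun i => by
    have : (fun y => gaussVec b V y i) = fun y => gauss b y * QPoly.eval (V i) y := funext fun y => gaussVec_apply b V y i
    rw [this]; exact differentiableAt_gaussPoly b (V i) y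

/-- `e^{−b|y|²}·V` is smooth. -/
theorem contDiff_gaussVec (b : ℝ) (V : Fin 3 → QPoly) {n : WithTop ℕ∞} : ContDiff ℝ n (gaussVec b V) :=
  contDiff_euclidean.mpr fun i => by
    have : (fun y => gaussVec b V y i) = fun y => gauss b y * QPoly.eval (V i) y := funext fun y => gaussVec_apply b V y i
    rw [this]; exact contDiff_gaussPoly b (V i)

/-- `∂_j` of the `i`-th component of `e^{−b|y|²}·V`. -/
theorem fderiv_gaussVec_single (b : ℚ) (V : Fin 3 → QPoly) (y : E3) (i j : Fin 3) :
    fderiv ℝ (gaussVec (b : ℝ) V) y (EuclideanSpace.single j 1) i = gauss (b : ℝ) y * QPoly.eval (Dg b j (V i)) y := by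
  rw [← fderiv_apply_coord_vec3 (differentiableAt_gaussVec _ V y) i]
  have : (fun y => gaussVec (b : ℝ) V y i) = fun y => gauss (b : ℝ) y * QPoly.eval (V i) y :=
    funext fun y => gaussVec_apply _ V y i
  rw [this, fderiv_gaussPoly_single]

/-- The directional derivative `D(e^{−b|y|²}·V)(y)[v]`, componentwise. -/
theorem fderiv_gaussVec_apply (b : ℚ) (V : Fin 3 → QPoly) (y v : E3) (i : Fin 3) :
    fderiv ℝ (gaussVec (b : ℝ) V) y v i = gauss (b : ℝ) y * ∑ j : Fin 3, v j * QPoly.eval (Dg b j (V i)) y := by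
  rw [← fderiv_apply_coord_vec3 (differentiableAt_gaussVec _ V y) i, clm_apply_eq_sum, Finset.mul_sum]
  refine Finset.sum_congr rfl fun j _ => ?_
  rw [fderiv_apply_coord_vec3 (differentiableAt_gaussVec _ V y) i, fderiv_gaussVec_single]
  ring

/-- **Curl of a Gaussian × symbolic field**: `curl (e^{−b|y|²}·V) = e^{−b|y|²}·(curl_b V)`. -/
theorem curl_gaussVec (b : ℚ) (V : Fin 3 → QPoly) (y : E3) :
    curl (gaussVec (b : ℝ) V) y = gauss (b : ℝ) y • evalVec (curlG b V) y := by
  have hD := fderiv_gaussVec_single b V y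
  ext k
  rw [PiLp.smul_apply, smul_eq_mul]
  simp only [curl, evalVec, curlG, PiLp.toLp_apply]
  fin_cases k
  · simp only [Fin.zero_eta, Fin.isValue, Matrix.cons_val_zero, hD, QPoly.eval_norm, QPoly.eval_sub]
    ring
  · simp only [Fin.mk_one, Fin.isValue, Matrix.cons_val_one, Matrix.cons_val_zero, hD, QPoly.eval_norm,
      QPoly.eval_sub]
    ring
  · simp only [Fin.reduceFinMk, Fin.isValue, Matrix.cons_val, hD, QPoly.eval_norm, QPoly.eval_sub]
    ring

/-- Curl is additive (pointwise, for differentiable fields). -/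
theorem curl_add_apply {F G : E3 → E3} {y : E3} (hF : DifferentiableAt ℝ F y) (hG : DifferentiableAt ℝ G y) :
    curl (fun x => F x + G x) y = curl F y + curl G y := by
  have h : fderiv ℝ (fun x => F x + G x) y = fderiv ℝ F y + fderiv ℝ G y := fderiv_add hF hG
  ext k
  simp only [curl, h, PiLp.add_apply, PiLp.toLp_apply]
  fin_cases k <;> simp <;> ring

/-! ## The momentum residual of the witness -/

namespace WitnessRow

/-- The witness field is a Gaussian × symbolic field. -/
theorem field_eq_gaussVec (r : WitnessRow) : r.field = gaussVec ((r.a : ℚ) : ℝ) r.u := by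
  funext y; rw [WitnessRow.field, gaussVec, r.cast_a]

/-- The Laplacian of the witness, componentwise: `(ΔU)_i = e^{−a|y|²}·Σ_j (Dg_j Dg_j u_i)(y)`. -/
theorem laplacian_field_apply (r : WitnessRow) (y : E3) (i : Fin 3) :
    (Δ r.field) y i = gauss r.aR y *
      (QPoly.eval (Dg r.a 0 (Dg r.a 0 (r.u i))) y + QPoly.eval (Dg r.a 1 (Dg r.a 1 (r.u i))) y +
        QPoly.eval (Dg r.a 2 (Dg r.a 2 (r.u i))) y) := by
  rw [laplacian_apply_coord_vec3 (r.contDiff_field (n := 2)) y i]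
  have hUi : (fun y => r.field y i) = fun y => gauss ((r.a : ℚ) : ℝ) y * QPoly.eval (r.u i) y := by
    funext y; rw [r.field_apply, r.cast_a]
  rw [hUi]
  -- Δ Φ = Σ_j ∂_j ∂_j Φ for the smooth scalar Φ = e^{−a|y|²} u_i
  have hΦ : ContDiff ℝ 2 (fun y => gauss ((r.a : ℚ) : ℝ) y * QPoly.eval (r.u i) y) := contDiff_gaussPoly _ _
  have hlap : (Δ (fun y => gauss ((r.a : ℚ) : ℝ) y * QPoly.eval (r.u i) y)) y =
      ∑ j : Fin 3, fderiv ℝ (fun y => fderiv ℝ (fun y => gauss ((r.a : ℚ) : ℝ) y * QPoly.eval (r.u i) y) y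
        (EuclideanSpace.basisFun (Fin 3) ℝ j)) y (EuclideanSpace.basisFun (Fin 3) ℝ j) := by
    -- (verbatim the tree lemma `PeriodicCylinder.laplacian_eq_sum_fderiv_fderiv`)
    rw [InnerProductSpace.laplacian_eq_iteratedFDeriv_orthonormalBasis _ (EuclideanSpace.basisFun (Fin 3) ℝ)]
    refine Finset.sum_congr rfl fun j _ => ?_
    rw [iteratedFDeriv_two_apply]
    have hd : DifferentiableAt ℝ (fderiv ℝ (fun y => gauss ((r.a : ℚ) : ℝ) y * QPoly.eval (r.u i) y)) y :=
      ((hΦ.fderiv_right (m := 1) (by norm_num)).differentiable one_ne_zero) y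
    rw [fderiv_clm_apply hd (differentiableAt_const _), fderiv_const_apply]
    simp
  rw [hlap, Fin.sum_univ_three]
  simp only [EuclideanSpace.basisFun_apply]
  have hinner : ∀ j : Fin 3, (fun y => fderiv ℝ (fun y => gauss ((r.a : ℚ) : ℝ) y * QPoly.eval (r.u i) y) y
      (EuclideanSpace.single j 1)) = fun y => gauss ((r.a : ℚ) : ℝ) y * QPoly.eval (Dg r.a j (r.u i)) y :=
    fun j => funext fun y => fderiv_gaussPoly_single r.a (r.u i) y j
  rw [hinner 0, hinner 1, hinner 2, fderiv_gaussPoly_single, fderiv_gaussPoly_single, fderiv_gaussPoly_single,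
    r.cast_a]
  ring

/-- The momentum residual of the witness is `e^{−a|y|²}·linPart + e^{−2a|y|²}·nlPart`. -/
theorem momentumResidual_field (r : WitnessRow) :
    lerayMomentumResidual r.field =
      fun y => gaussVec ((r.a : ℚ) : ℝ) (linPart r.a r.u) y + gaussVec (((2 * r.a : ℚ)) : ℝ) (nlPart r.a r.u) y := by
  funext y
  ext i
  rw [PiLp.add_apply, gaussVec_apply, gaussVec_apply, lerayMomentumResidual]
  simp only [PiLp.add_apply, PiLp.neg_apply, PiLp.smul_apply, smul_eq_mul, convect]
  rw [r.laplacian_field_apply y i, r.field_apply y i]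
  rw [r.field_eq_gaussVec, fderiv_gaussVec_apply, fderiv_gaussVec_apply, Fin.sum_univ_three, Fin.sum_univ_three,
    gaussVec_apply, gaussVec_apply, gaussVec_apply]
  -- values of linPart / nlPart
  have hlin : QPoly.eval (linPart r.a r.u i) y =
      -(QPoly.eval (Dg r.a 0 (Dg r.a 0 (r.u i))) y + QPoly.eval (Dg r.a 1 (Dg r.a 1 (r.u i))) y +
          QPoly.eval (Dg r.a 2 (Dg r.a 2 (r.u i))) y) + (1 / 2 : ℝ) * QPoly.eval (r.u i) y +
        (1 / 2 : ℝ) * (y 0 * QPoly.eval (Dg r.a 0 (r.u i)) y + y 1 * QPoly.eval (Dg r.a 1 (r.u i)) y +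
          y 2 * QPoly.eval (Dg r.a 2 (r.u i)) y) := by
    simp only [linPart, QPoly.eval_norm, QPoly.eval_add, QPoly.eval_scale, QPoly.eval_mulVar]
    push_cast; ring
  have hnl : QPoly.eval (nlPart r.a r.u i) y =
      QPoly.eval (r.u 0) y * QPoly.eval (Dg r.a 0 (r.u i)) y + QPoly.eval (r.u 1) y * QPoly.eval (Dg r.a 1 (r.u i)) y +
        QPoly.eval (r.u 2) y * QPoly.eval (Dg r.a 2 (r.u i)) y := by
    simp only [nlPart, QPoly.eval_norm, QPoly.eval_add, QPoly.eval_mul]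
  rw [hlin, hnl]
  have hcast : (((2 * r.a : ℚ)) : ℝ) = 2 * r.aR := by push_cast; rw [r.cast_a]
  have e2 : gauss (((2 * r.a : ℚ)) : ℝ) y = gauss r.aR y * gauss r.aR y := by rw [hcast, gauss_mul]; ring_nf
  rw [e2, r.cast_a]
  ring

/-- **S3 (DISCHARGED): the vorticity residual of the witness is `e^{−a|y|²}·g₁ + e^{−2a|y|²}·g₂`.** -/
theorem vorticityResidual_field (r : WitnessRow) (y : E3) :
    lerayVorticityResidual r.field y = gauss r.aR y • evalVec r.g1 y + gauss (2 * r.aR) y • evalVec r.g2 y := by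
  rw [lerayVorticityResidual, r.momentumResidual_field,
    curl_add_apply (differentiableAt_gaussVec _ _ y) (differentiableAt_gaussVec _ _ y)]
  rw [curl_gaussVec, curl_gaussVec, r.cast_a]
  have hcast : (((2 * r.a : ℚ)) : ℝ) = 2 * r.aR := by push_cast; rw [r.cast_a]
  rw [hcast]
  rfl

end WitnessRow

end Summit.NavierStokesRegularity.NavierStokesRegularity.Cruxes.ScarEnvelopeTypeI.ForcedTsai

end
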